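import Summits.BirchSwinnertonDyer.BirchSwinnertonDyer.Theorems.GoldfeldAllTwistsTwoConverseTwinQuarterTraceAlphaThreeModEightPlusOfPrint
import Summits.BirchSwinnertonDyer.BirchSwinnertonDyer.Theorems.GoldfeldAllTwistsTwoConverseTwinQuarterTraceAlphaPlusOfPrint
import HarnessLib

set_option linter.dupNamespace false -- namespace `…BirchSwinnertonDyer.BirchSwinnertonDyer…` is the cell's (D-0017 nested layout)
set_option autoImplicit false

/-!
# ORDER (cdiv) object 6, file U⁺-α: the RANK-AXIS CAPSTONE on EVERY type-α two-prime cell with `(p/q) = +1` — THEOREM A⁗_α⁺ on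
# A7⁺ ∪ A3⁺ = a71+ ∪ a75+ ∪ a31+ ∪ a35+ (`q ≡ 3 (mod 4)`, `q > 3`) as ONE statement, by cases on `q mod 8`, by name

Cell `bsd-goldfeld`, seat `bsd-goldfeld-s1p-c3x` (gen 17); planner RULING (cdiv) (β): «the α⁺ UNION capstone over q mod 8: ONE by-name file 'by cases on
q % 8' AFTER T5 is accepted, allow-list = Z3's SIXTEEN exactly (the A7⁺ half keeps `hBCST`/`hpar` for its `h2`), ≤ 150 lines, no new content».
`--supports stmt-BirchSwinnertonDyer-20044` as a HELPER (rank axis). Theses-free; ONE theorem; no definition, no new fact, no `sorry`, no kit.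
The two halves: `q ≡ 7 (mod 8)` = A7⁺'s Z⁺-2 `analyticRank_eq_one_twoPrimesTwist_alphaPlus_modFour_of_print` (`…QuarterTraceAlphaPlusOfPrint` §4, seat c3x g15;
the χ_Z channel at the lift `σ̃_q`, value `[h2]`, `h2` by the (2,4) descents D3⁺ + `hpar` + `hBCST` — SIXTEEN prints); `q ≡ 3 (mod 8)` = T5
`analyticRank_eq_one_twoPrimesTwist_alphaThreeModEightPlus_of_print` (`…QuarterTraceAlphaThreeModEightPlusOfPrint`, this seat; the χ_Z channel at the lift
`σ̃_p`, value `T` unconditionally — FOURTEEN prints, `hBCST`/`hpar` idle on this half). HONEST FRAMING: a WITNESS FAMILY of twist-density ZERO modulo named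
print (SELMER-DRIFT ceiling); FRONTIER-grade, never distance-to-summit; not a closer of any item; items 19350 / 19140 / 20044 unchanged; BSD is not proved by
any of this.
-/

noncomputable section

open scoped Classical

open WeierstrassCurve NumberField Literature.NumberTheory Literature.NumberTheory.EllipticCurves
  Literature.NumberTheory.EllipticCurves.ModularForms Literature.NumberTheory.EllipticCurves.CaiShuTian2014
  Literature.NumberTheory.EllipticCurves.CoatesLiTianZhai2015

namespace Summit.BirchSwinnertonDyer.BirchSwinnertonDyer.Theorems.GoldfeldGoodTwists

section UnionAlphaPlus

variable (hCST : thm11_ringClassChar)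
  (hGZ : ∀ (N : ℕ) [NeZero N] (W : WeierstrassCurve ℚ) (K : Type) [Field K] [NumberField K], gross_zagier N W K)
  (h12 : thm12_fullBSD_twist) (h44 : thm44_ord_two_LAlg) (h14 : thm14_rankOne_twist)
  (hS31 : bsdTriple_of_rank_le_one_of_conductor_lt) (hnew : exists_isNewformOf) (hM : OptimalCurveManinCertificate cm7)
  (hBT : burungaleTian_analyticRank_eq_zero_of_selmerCorank_eq_zero_of_hasCM) (hBF : bsdTriple_of_hasCM_of_L_one_ne_zero)
  (hGZK : rank_eq_analyticRank_of_analyticRank_le_one) (hEta : x049_heegner_norm_x_sub_two_not_mem)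
  (hEta₀ : x049_x_sub_two_eq_etaQuotient) (hD : deuring_etaQuotient49_heegner_generates_conjPrime)
  (hBCST : BurungaleCastellaSkinnerTian2022.thmA_analyticRank_eq_one_of_selmerCorank_eq_one)
  (hpar : ∀ (V : WeierstrassCurve ℚ) [V.IsElliptic], p_parity V 2)
include hCST hGZ h12 h44 h14 hS31 hnew hM hBT hBF hGZK hEta hEta₀ hD hBCST hpar

/-- **THEOREM A⁗_α⁺ ON EVERY type-α cell with `(p/q) = +1`, FROM PRINT**: for primes `q > 3`, `q ≡ 3 (mod 4)`, `(q/7) = −1`, and `p ≡ 1 (mod 4)`,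
`(−7/p) = +1`, `−7` NOT a fourth power mod `p`, with `(p/q) = +1`, and every `W ≅ 49a1^{(−2qp)}`: `r_an(W) = 1`, `rank W(ℚ) = 1`, `Ш(W)` finite —
by cases on `q mod 8` onto A7⁺ (Z⁺-2, lift `σ̃_q`, needs `hBCST`/`hpar`) ∣ A3⁺ (T5, lift `σ̃_p`, needs neither). SIXTEEN named binders, nothing else;
twist-density ZERO; not a closer of any item; BSD is not proved. [cite: CoatesLiTianZhai2015, Thm. 1.2 (p. 359) and Thm. 1.4] [cite: GrossZagier1986, Thm. I.(6.3) and I.§7]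
[cite: Gross1984, §§4–5] [cite: GrossLMS1991, Prop. 5.3] [cite: BurungaleCastellaSkinnerTian2022, Thm. A (p. 326)] -/
theorem analyticRank_eq_one_twoPrimesTwist_alphaPlus_threeModFour_of_print
    {q p : ℕ} (hq : q.Prime) (h3 : 3 < q) (hq4 : q % 4 = 3) (hq7 : jacobiSym q 7 = -1)
    [Fact p.Prime] (hp4 : p % 4 = 1) (hp7 : legendreSym p (-7) = 1) (hα : ¬ ∃ x : ZMod p, x ^ 4 = -7) (hpq : jacobiSym (p : ℤ) q = 1)
    (W : WeierstrassCurve ℚ) [W.IsElliptic] (C : VariableChange ℚ) (hC : C • W = cm7.quadraticTwist (-(2 * (q : ℚ) * p))) :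
    W.analyticRank = 1 ∧ W.mordellWeilRank = 1 ∧ Finite W.sha := by
  obtain hq8 | hq8 : q % 8 = 3 ∨ q % 8 = 7 := by omega
  · exact analyticRank_eq_one_twoPrimesTwist_alphaThreeModEightPlus_of_print hCST hGZ h12 h44 h14 hS31 hnew hM hBT hBF hGZK hEta hEta₀ hD hq hq8 h3
      hq7 hp4 hp7 hα hpq W C hC
  · exact analyticRank_eq_one_twoPrimesTwist_alphaPlus_modFour_of_print hCST hGZ h12 h44 h14 hS31 hnew hM hBT hBF hGZK hEta hEta₀ hD hBCST hpar hq hq8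
      hq7 hp4 hp7 hα hpq W C hC

end UnionAlphaPlus

end Summit.BirchSwinnertonDyer.BirchSwinnertonDyer.Theorems.GoldfeldGoodTwists

end
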